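import Literature.IUT.HodgeTheaters.KitNFSideProp67
import Literature.IUT.HodgeTheaters.KitNFLinkNonVacuityWitness

/-!
# NV-L5 witness: the multiplicative-kit-generated evaluation binder at CLOSED data — `hne`, `hrig`, `hsat` of
# abc-iut-L5-t3's `thetaAgrees_ofKit` discharged over every thickened kit, so that `ThetaAgrees` and the
# Proposition-6.7 theorems over `KitCore.ofKit … (M.evalBinder …)` FIRE at closed data with `𝕍^bad ≠ ∅`
# ([IUTchI] Ex 4.4 (i)(ii)(iv), Def 4.6 (ii), Prop 6.7) — post-freeze additive D13, WITNESS class [toy, 𝕍^bad ≠ ∅],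
# not a cone member, not citable at 11:30Z

S. Mochizuki, *Inter-universal Teichmüller theory I*, kurims manuscript (May 2020), Example 4.4 (i), (ii), (iv)
pp. 105–107, Definition 4.6 (ii) p. 111, Proposition 6.7 p. 167 ([IUTchI] Prop 6.7 p.167) [claim: Mochizuki2012, status: disputed]
(D-0012 claim key, series status DISPUTED; CONSISTENCY / NON-VACUITY witness for hypothesis structures of the cell's
typing — nothing of the series is asserted, no side is taken on [IUTchIII] Cor. 3.12; witnessed ≠ endorsed).

## What is witnessed (L5-lead RULINGS #43 (4) «GO L5-t17 (α) NV-MULTKIT-EVALBINDER»)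

abc-iut-L5-t3's `BaseThetaDatum.thetaAgrees_ofKit K hl5 hba hb N B M Z hne hrig hsat` (`KitNFSideEval.lean`) and the
Proposition-6.7 theorems of `KitNFSideProp67.lean` (`thetaBridgeAlgorithm_ofKit`, `thetaBridgeData_isModel_ofKit`,
`card_thetaBridgeData_hom_ofKit`, `isModelConjugate_iff_exists_dThetaBridge_ofKit`) are stated over the converse
dictionary `KitCore.ofKit K … N B (M.evalBinder hl5 Z hne hrig)` whose evaluation sections are GENERATED by a
multiplicative kit `M` and a zero class `Z`, under `hne` (Ex 4.4 (i): every label occurs), `hrig` (Ex 4.4 (iv):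
labels rigid under two-sided automorphisms of `𝒟_v`) and `hsat` (Ex 4.4 (ii): bi-saturation).  Here:

* over ANY thickened kit `K.thicken` (abc-iut-L5-t3's `KitCoreBridgeWitness.lean`) with its multiplicative kit
  `K.thickMultKit` and the THICK ZERO CLASS `thickZeroClass K` (morphisms of `(𝒟_v, pt)` with `Thick`-component
  `|0| + 1 = 1`), the `|𝔽_l|`-indexed classes are uniformly "Thick-component `= |j| + 1`"
  (`mem_thickMultKit_thetaPolyBad_iff`, `mem_thick_polyOfLabel_iff`), whence `hne` (`thick_polyOfLabel_nonempty`),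
  `hrig` (`thick_polyOfLabel_rigid`) and `hsat` (`thickMultKit_thetaPolyBad_saturated`) — automorphisms of
  `(𝒟_v, pt)` have `Thick`-component `0`;
* `PMBaseKit.EvalBinder.thickMult K hl5 hdis hbad := (K.thickMultKit …).evalBinder hl5 (thickZeroClass K) hne hrig` —
  the multiplicative-kit-GENERATED evaluation binder of a thickened kit (same classes as `EvalBinder.thick` of
  `KitNFLinkNonVacuityWitness.lean`, now in abc-iut-L5-t3's `ofModelSets` form);
* FIRED at closed data: `ThetaAgrees` (`thetaAgrees_ofKit_thick` for every thickened kit with any NF kit / mono-analytic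
  binder; `thetaAgrees_ofKit_toy` at the thickened one-bad-place toy kit with `NFKit.toyBad`, `MonoBinder.tautological`),
  the Prop 6.7 algorithm `thetaBridgeAlgorithm_ofKit_toy`, and — universally in the `𝒟-Θ^±`-bridge / bridge-data
  arguments, whose inhabitation over the thickened toy kit is NOT witnessed here — `thetaBridgeData_isModel_ofKit_toy`,
  `card_thetaBridgeData_hom_ofKit_toy`, `isModelConjugate_iff_exists_dThetaBridge_ofKit_toy`; packaged
  `exists_thetaAgrees_ofKit`.

NOT fired here (honest limit): the universe-`u+1` «Consequences» of `KitNFSideEval.lean` (`gluingTransportLaw_and_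
gluingUniqueBad_ofKit`, `gluingUnique_ofKit`) — abc-iut-L5-t3's `thicken` is stated for `PMBaseKit.{0}` only, and they
need moreover an `S5Local`/`FKitCore` over the datum; a universe-polymorphic thickening would be a new definition.
DEGENERATE toy data, labelled as such. typed ≠ inhabited ≠ discharged.
-/

namespace Literature.IUT.HodgeTheaters

open CategoryTheory

namespace PMBaseKit

variable {l : ℕ} (K : PMBaseKit.{0} l)

/-- An automorphism of the thickened model `(𝒟_v, pt)` has trivial `Thick`-component (`(ℕ, +)` has no units but
`0`). (model plumbing for [IUTchI] Ex 4.4 (ii) p. 107) ([IUTchI] Ex 4.4 (ii) p.107) [claim: Mochizuki2012, status: disputed] -/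
theorem thicken_val_iso_model {x : K.V} (θ : K.thicken.model x ≅ K.thicken.model x) : Thick.val θ.hom.2 = 1 :=
  Thick.val_iso_hom ((CategoryTheory.Prod.snd (K.Amb x) Thick).mapIso θ)

/-- The `Thick`-component of a two-sided composite with automorphisms of `(𝒟_v, pt)` is that of the middle term.
(model plumbing for [IUTchI] Ex 4.4 (ii) p. 107) ([IUTchI] Ex 4.4 (ii) p.107) [claim: Mochizuki2012, status: disputed] -/
theorem thicken_val_conj {x : K.V} (θ β : K.thicken.model x ≅ K.thicken.model x)
    (g : K.thicken.model x ⟶ K.thicken.model x) : Thick.val (θ.hom ≫ g ≫ β.hom).2 = Thick.val g.2 := by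
  change Thick.val β.hom.2 * Thick.val g.2 * Thick.val θ.hom.2 = _
  rw [K.thicken_val_iso_model θ, K.thicken_val_iso_model β, one_mul, mul_one]

/-- **The thick zero class** (the "zero-labeled" evaluation sections of Example 4.4 (i) — an INPUT `Z` of
abc-iut-L5-t3's `MultKit.polyOfLabel`, not carried by any kit — at a thickened kit): the endomorphisms of `(𝒟_v, pt)`
with `Thick`-component `|0| + 1`. ([IUTchI] Ex 4.4 (i) p.105) [claim: Mochizuki2012, status: disputed] -/
def thickZeroClass : ∀ x : K.thicken.V, x ∈ K.thicken.bad → Set (K.thicken.model x ⟶ K.thicken.model x) :=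
  fun _ _ => {g | Thick.val g.2 = Multiplicative.ofAdd (FlAbs.absVal l (FlAbs.zero l) + 1)}

variable [Fact l.Prime]

/-- **The Example-4.4 classes of the thick multiplicative kit**: at a bad place, `g ∈ φ^Θ_{v_j}` (label `[j+1]`) iff
the `Thick`-component of `g` is `|[j+1]| + 1`. ([IUTchI] Ex 4.4 (i) p.105) [claim: Mochizuki2012, status: disputed] -/
theorem mem_thickMultKit_thetaPolyBad_iff (hl5 : 5 ≤ l) (hdis : Disjoint K.bad K.arc) (hbad : K.bad.Nonempty)
    {x : K.V} (hx : x ∈ K.bad) (j : Fin (lStar l)) (g : K.thicken.model x ⟶ K.thicken.model x) :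
    g ∈ (K.thickMultKit hl5 hdis hbad).thetaPolyBad j x hx ↔
      Thick.val g.2 = Multiplicative.ofAdd (FlAbs.absVal l (FlStar.toFlAbs l (FlStar.ofFin l j)) + 1) := by
  constructor
  · rintro ⟨f, hf, rfl⟩
    have h : Thick.val f.hom.2 = _ := hf.1 hx
    change Thick.val ((Iso.refl _).inv ≫ f.hom ≫ (Iso.refl _).hom).2 = _
    rw [Iso.refl_inv, Iso.refl_hom, Category.id_comp, Category.comp_id]
    exact h
  · intro h
    refine ⟨ObjectProperty.homMk g, ⟨fun _ => h, fun hn => absurd hx hn⟩, ?_⟩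
    change g = (Iso.refl _).inv ≫ g ≫ (Iso.refl _).hom
    rw [Iso.refl_inv, Iso.refl_hom, Category.id_comp, Category.comp_id]

/-- **The `|𝔽_l|`-indexed classes of the thick multiplicative kit with the thick zero class**: uniformly in
`j ∈ |𝔽_l|`, `g ∈` the class of `j` iff its `Thick`-component is `|j| + 1`. ([IUTchI] Ex 4.4 (i) p.105) [claim: Mochizuki2012, status: disputed] -/
theorem mem_thick_polyOfLabel_iff (hl5 : 5 ≤ l) (hdis : Disjoint K.bad K.arc) (hbad : K.bad.Nonempty)
    {x : K.V} (hx : x ∈ K.bad) (j : FlAbs l) (g : K.thicken.model x ⟶ K.thicken.model x) :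
    g ∈ (K.thickMultKit hl5 hdis hbad).polyOfLabel hl5 K.thickZeroClass x hx j ↔
      Thick.val g.2 = Multiplicative.ofAdd (FlAbs.absVal l j + 1) := by
  rcases FlAbs.eq_zero_or_exists_eq l j with rfl | ⟨s, rfl⟩
  · rw [MultKit.polyOfLabel_zero]
    rfl
  · obtain ⟨i, rfl⟩ := (FlStar.ofFin_bijective l (MultKit.two_ne_of_five_le hl5)).2 s
    rw [MultKit.polyOfLabel_ofFin]
    exact K.mem_thickMultKit_thetaPolyBad_iff hl5 hdis hbad hx i g

/-- **`hne` discharged** (Ex 4.4 (i): every label occurs): the class of `j` contains `(𝟙, |j| + 1)`.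
([IUTchI] Ex 4.4 (i) p.105) [claim: Mochizuki2012, status: disputed] -/
theorem thick_polyOfLabel_nonempty (hl5 : 5 ≤ l) (hdis : Disjoint K.bad K.arc) (hbad : K.bad.Nonempty) :
    ∀ x (hx : x ∈ K.thicken.bad) (j : FlAbs l),
      ((K.thickMultKit hl5 hdis hbad).polyOfLabel hl5 K.thickZeroClass x hx j).Nonempty :=
  fun x hx j =>
    ⟨Prod.mkHom (𝟙 (K.model x)) (Multiplicative.ofAdd (FlAbs.absVal l j + 1) : Multiplicative ℕ),
      (K.mem_thick_polyOfLabel_iff hl5 hdis hbad hx j _).2 rfl⟩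

/-- **`hrig` discharged** (Ex 4.4 (iv) / [EtTh] Cor. 2.9 label rigidity, at the toy): two classes related by
two-sided automorphisms of `(𝒟_v, pt)` have the same label (automorphisms have `Thick`-component `0`, `j ↦ |j|` is
injective). ([IUTchI] Ex 4.4 (iv) p.107) [claim: Mochizuki2012, status: disputed] -/
theorem thick_polyOfLabel_rigid (hl5 : 5 ≤ l) (hdis : Disjoint K.bad K.arc) (hbad : K.bad.Nonempty) :
    ∀ x (hx : x ∈ K.thicken.bad) {j j' : FlAbs l} {g g' : K.thicken.model x ⟶ K.thicken.model x}
      (θ β : K.thicken.model x ≅ K.thicken.model x),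
      g ∈ (K.thickMultKit hl5 hdis hbad).polyOfLabel hl5 K.thickZeroClass x hx j →
      g' ∈ (K.thickMultKit hl5 hdis hbad).polyOfLabel hl5 K.thickZeroClass x hx j' →
      g' = θ.hom ≫ g ≫ β.hom → j = j' := by
  intro x hx j j' g g' θ β hg hg' h
  rw [mem_thick_polyOfLabel_iff] at hg hg'
  have h1 : Thick.val g'.2 = Thick.val g.2 := by rw [h, K.thicken_val_conj]
  have h2 := Multiplicative.ofAdd.injective (hg.symm.trans (h1.symm.trans hg'))
  exact FlAbs.absVal_injective l (by omega)

/-- **`hsat` discharged** (Ex 4.4 (ii) "composing with arbitrary isomorphisms", read on the model): the classes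
`φ^Θ_{v_j}` of the thick multiplicative kit are bi-saturated under automorphisms of `(𝒟_v, pt)`.
([IUTchI] Ex 4.4 (ii) p.107) [claim: Mochizuki2012, status: disputed] -/
theorem thickMultKit_thetaPolyBad_saturated (hl5 : 5 ≤ l) (hdis : Disjoint K.bad K.arc) (hbad : K.bad.Nonempty) :
    ∀ x (hx : x ∈ K.thicken.bad) (j : Fin (lStar l)) (θ β : K.thicken.model x ≅ K.thicken.model x)
      {g : K.thicken.model x ⟶ K.thicken.model x},
      g ∈ (K.thickMultKit hl5 hdis hbad).thetaPolyBad j x hx →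
        θ.hom ≫ g ≫ β.hom ∈ (K.thickMultKit hl5 hdis hbad).thetaPolyBad j x hx := by
  intro x hx j θ β g hg
  rw [mem_thickMultKit_thetaPolyBad_iff] at hg ⊢
  rw [K.thicken_val_conj]
  exact hg

/-- **The multiplicative-kit-GENERATED evaluation binder of a thickened kit**: abc-iut-L5-t3's
`MultKit.evalBinder` at the thick multiplicative kit and the thick zero class, with `hne`/`hrig` DISCHARGED
(Example 4.4's evaluation sections "generated by the kit", `ofModelSets` form). ([IUTchI] Ex 4.4 (ii) p.107) [claim: Mochizuki2012, status: disputed] -/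
noncomputable def EvalBinder.thickMult (hl5 : 5 ≤ l) (hdis : Disjoint K.bad K.arc) (hbad : K.bad.Nonempty) :
    K.thicken.EvalBinder :=
  (K.thickMultKit hl5 hdis hbad).evalBinder hl5 K.thickZeroClass (K.thick_polyOfLabel_nonempty hl5 hdis hbad)
    (K.thick_polyOfLabel_rigid hl5 hdis hbad)

/-- `𝕍^bad ∩ 𝕍^arc = ∅` for the one-bad-place toy kit, in `Disjoint` form. ([IUTchI] Def 3.1 (e) p.62) [claim: Mochizuki2012, status: disputed] -/
theorem toyKitBad_disjoint (hl5 : 5 ≤ l) : Disjoint (toyKitBad l hl5).bad (toyKitBad l hl5).arc :=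
  Finset.disjoint_empty_right _

/-- `l` is odd for a prime `l ≥ 5` (Def 3.1 (c)). ([IUTchI] Def 3.1 (c) p.61) [claim: Mochizuki2012, status: disputed] -/
theorem odd_of_five_le (hl5 : 5 ≤ l) : Odd l :=
  (Fact.out : l.Prime).odd_of_ne_two (MultKit.two_ne_of_five_le hl5)

end PMBaseKit

namespace BaseThetaDatum

open PMBaseKit

section Thick

variable {l : ℕ} (K : PMBaseKit.{0} l) [Fact l.Prime] (hl5 : 5 ≤ l) (hdis : Disjoint K.bad K.arc)
  (hbad : K.bad.Nonempty) (hba : ∀ x ∈ K.thicken.bad, x ∉ K.thicken.arc) (N : K.thicken.NFKit)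
  (B : K.thicken.MonoBinder)

/-- **`ThetaAgrees` over the datum built from a thickened kit, UNCONDITIONALLY in the kit's classes**: for any base
kit `K` (universe `0`) with `𝕍^bad ∩ 𝕍^arc = ∅`, `𝕍^bad ≠ ∅`, any NF kit and mono-analytic binder over `K.thicken`, the
converse dictionary with the kit-generated evaluation binder `EvalBinder.thickMult` Θ-AGREES with the thick
multiplicative kit — abc-iut-L5-t3's `thetaAgrees_ofKit` with `hne`/`hrig`/`hsat` discharged.
([IUTchI] Prop 6.7 p.167) [claim: Mochizuki2012, status: disputed] -/
theorem thetaAgrees_ofKit_thick :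
    (KitCore.ofKit K.thicken hl5 hba hbad N B (EvalBinder.thickMult K hl5 hdis hbad)).ThetaAgrees
      (K.thickMultKit hl5 hdis hbad) :=
  thetaAgrees_ofKit _ hl5 hba hbad N B _ _ _ _ (K.thickMultKit_thetaPolyBad_saturated hl5 hdis hbad)

/-- **Prop 6.7's functorial algorithm FIRES over every thickened kit**: abc-iut-L5-t3's `thetaBridgeAlgorithm_ofKit`
with `hne`/`hrig`/`hsat` discharged (`l` odd from Def 3.1 (c)). ([IUTchI] Prop 6.7 p.167) [claim: Mochizuki2012, status: disputed] -/
theorem thetaBridgeAlgorithm_ofKit_thick :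
    PMBaseKit.DThetaPMBridge.ThetaBridgeAlgorithm (K.thickMultKit hl5 hdis hbad)
      (fun D => ∃ (B' : (ofKitCore K.thicken hl5 hba hbad N B (EvalBinder.thickMult K hl5 hdis hbad)).DThetaBridge)
          (ι : D.J ≃ B'.J) (κ : ∀ j x, (B'.capsule (ι j) x).obj ≅ (D.capsule j).obj x)
          (γ : ∀ x, (B'.cod x).obj ≅ D.codomain.obj x),
          ∀ j x, D.poly j x = {g | ∃ f ∈ B'.poly (ι j) x, g = (κ j x).inv ≫ f.hom ≫ (γ x).hom})
      (odd_of_five_le hl5) :=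
  thetaBridgeAlgorithm_ofKit _ hl5 hba N B _ _ _ _ hbad (K.thickMultKit_thetaPolyBad_saturated hl5 hdis hbad) _

include hba N B in
/-- **"well-defined up to a UNIQUE isomorphism" FIRES over every thickened kit** (for all `𝒟-Θ^±`-bridges `B₁, B₂` of
the thickened kit — their inhabitation is not witnessed here): abc-iut-L5-t3's `card_thetaBridgeData_hom_ofKit` with
the atoms discharged (the NF kit `N` and the binder `B` enter only because the dictionary instance is stated over the
full datum, as in abc-iut-L5-t3's original). ([IUTchI] Prop 6.7 p.167) [claim: Mochizuki2012, status: disputed] -/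
theorem card_thetaBridgeData_hom_ofKit_thick (B₁ B₂ : K.thicken.DThetaPMBridge) :
    Nat.card (PMBaseKit.DThetaBridgeData.Hom (B₁.thetaBridgeData (K.thickMultKit hl5 hdis hbad) (odd_of_five_le hl5))
      (B₂.thetaBridgeData (K.thickMultKit hl5 hdis hbad) (odd_of_five_le hl5))) = 1 :=
  card_thetaBridgeData_hom_ofKit _ hl5 hba N B _ _ (K.thick_polyOfLabel_nonempty hl5 hdis hbad)
    (K.thick_polyOfLabel_rigid hl5 hdis hbad) hbad (K.thickMultKit_thetaPolyBad_saturated hl5 hdis hbad) _ B₁ B₂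

end Thick

section Toy

variable (l : ℕ) [Fact l.Prime] (hl5 : 5 ≤ l)

/-- **NV-L5 `ThetaAgrees` at the converse-dictionary instance WITNESSED [toy, 𝕍^bad ≠ ∅; degenerate]**: at the CLOSED
data of `KitNFLinkNonVacuityWitness.lean` — the thickened one-bad-place toy kit, its NF kit `NFKit.toyBad`, the
tautological mono-analytic binder — with the kit-generated evaluation binder, `ThetaAgrees` HOLDS; so the antecedents
of abc-iut-L5-t3's `thetaAgrees_ofKit` are jointly satisfiable with `𝕍^bad ≠ ∅`, for every prime `l ≥ 5`.
([IUTchI] Prop 6.7 p.167) [claim: Mochizuki2012, status: disputed] -/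
theorem thetaAgrees_ofKit_toy :
    (KitCore.ofKit (toyKitBad l hl5).thicken hl5 (toyKitBad_bad_not_arc hl5) (toyKitBad_bad_nonempty hl5)
      (NFKit.toyBad l hl5) (MonoBinder.tautological _)
      (EvalBinder.thickMult (toyKitBad l hl5) hl5 (toyKitBad_disjoint hl5) (toyKitBad_bad_nonempty hl5))).ThetaAgrees
      ((toyKitBad l hl5).thickMultKit hl5 (toyKitBad_disjoint hl5) (toyKitBad_bad_nonempty hl5)) :=
  thetaAgrees_ofKit_thick _ hl5 _ _ _ _ _

/-- **Prop 6.7's functorial algorithm FIRES at the closed toy data** [toy, 𝕍^bad ≠ ∅]. ([IUTchI] Prop 6.7 p.167) [claim: Mochizuki2012, status: disputed] -/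
theorem thetaBridgeAlgorithm_ofKit_toy :
    PMBaseKit.DThetaPMBridge.ThetaBridgeAlgorithm
      ((toyKitBad l hl5).thickMultKit hl5 (toyKitBad_disjoint hl5) (toyKitBad_bad_nonempty hl5))
      (fun D => ∃ (B' : (ofKitCore (toyKitBad l hl5).thicken hl5 (toyKitBad_bad_not_arc hl5)
            (toyKitBad_bad_nonempty hl5) (NFKit.toyBad l hl5) (MonoBinder.tautological _)
            (EvalBinder.thickMult (toyKitBad l hl5) hl5 (toyKitBad_disjoint hl5)
              (toyKitBad_bad_nonempty hl5))).DThetaBridge)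
          (ι : D.J ≃ B'.J) (κ : ∀ j x, (B'.capsule (ι j) x).obj ≅ (D.capsule j).obj x)
          (γ : ∀ x, (B'.cod x).obj ≅ D.codomain.obj x),
          ∀ j x, D.poly j x = {g | ∃ f ∈ B'.poly (ι j) x, g = (κ j x).inv ≫ f.hom ≫ (γ x).hom})
      (odd_of_five_le hl5) :=
  thetaBridgeAlgorithm_ofKit_thick _ hl5 _ _ _ _ _

/-- **Def 4.6 (ii)'s `isModel` clause for the Prop 6.7 outputs FIRES at the closed toy data**, for every
`𝒟-Θ^±`-bridge `Bpm` of the thickened toy kit (inhabitation of that bridge structure is not witnessed here)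
[toy, 𝕍^bad ≠ ∅]. ([IUTchI] Def 4.6 (ii) p.111) [claim: Mochizuki2012, status: disputed] -/
theorem thetaBridgeData_isModel_ofKit_toy (Bpm : (toyKitBad l hl5).thicken.DThetaPMBridge) :
    ∃ (ι : FlStar l ≃ (Bpm.thetaBridgeData ((toyKitBad l hl5).thickMultKit hl5 (toyKitBad_disjoint hl5)
          (toyKitBad_bad_nonempty hl5)) (odd_of_five_le hl5)).J)
      (κ : ∀ j, (PMBaseKit.DStrip.model (toyKitBad l hl5).thicken).Iso
        ((Bpm.thetaBridgeData ((toyKitBad l hl5).thickMultKit hl5 (toyKitBad_disjoint hl5)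
          (toyKitBad_bad_nonempty hl5)) (odd_of_five_le hl5)).capsule (ι j)))
      (δ : (PMBaseKit.DStrip.model (toyKitBad l hl5).thicken).Iso
        (Bpm.thetaBridgeData ((toyKitBad l hl5).thickMultKit hl5 (toyKitBad_disjoint hl5)
          (toyKitBad_bad_nonempty hl5)) (odd_of_five_le hl5)).codomain),
      ∀ (j : FlStar l) (x : (toyKitBad l hl5).thicken.V),
        (Bpm.thetaBridgeData ((toyKitBad l hl5).thickMultKit hl5 (toyKitBad_disjoint hl5)
          (toyKitBad_bad_nonempty hl5)) (odd_of_five_le hl5)).poly (ι j) x =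
        {h | ∃ f ∈ (ofKitCore (toyKitBad l hl5).thicken hl5 (toyKitBad_bad_not_arc hl5)
              (toyKitBad_bad_nonempty hl5) (NFKit.toyBad l hl5) (MonoBinder.tautological _)
              (EvalBinder.thickMult (toyKitBad l hl5) hl5 (toyKitBad_disjoint hl5)
                (toyKitBad_bad_nonempty hl5))).modelThetaBridge j x,
          h = (κ j x).inv ≫ f.hom ≫ (δ x).hom} :=
  thetaBridgeData_isModel_ofKit _ hl5 _ _ _ _ _ _ _ _
    ((toyKitBad l hl5).thickMultKit_thetaPolyBad_saturated hl5 (toyKitBad_disjoint hl5)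
      (toyKitBad_bad_nonempty hl5)) _ Bpm

/-- **"well-defined up to a UNIQUE isomorphism" FIRES at the closed toy data**, for all `𝒟-Θ^±`-bridges `B₁, B₂` of
the thickened toy kit [toy, 𝕍^bad ≠ ∅]. ([IUTchI] Prop 6.7 p.167) [claim: Mochizuki2012, status: disputed] -/
theorem card_thetaBridgeData_hom_ofKit_toy (B₁ B₂ : (toyKitBad l hl5).thicken.DThetaPMBridge) :
    Nat.card (PMBaseKit.DThetaBridgeData.Hom
      (B₁.thetaBridgeData ((toyKitBad l hl5).thickMultKit hl5 (toyKitBad_disjoint hl5) (toyKitBad_bad_nonempty hl5))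
        (odd_of_five_le hl5))
      (B₂.thetaBridgeData ((toyKitBad l hl5).thickMultKit hl5 (toyKitBad_disjoint hl5) (toyKitBad_bad_nonempty hl5))
        (odd_of_five_le hl5))) = 1 :=
  card_thetaBridgeData_hom_ofKit_thick _ hl5 _ _ (toyKitBad_bad_not_arc hl5) (NFKit.toyBad l hl5)
    (MonoBinder.tautological _) B₁ B₂

/-- **The two readings of Def 4.6 (ii) agree at the closed toy data**, for every bridge datum `D` of the thickened
toy kit [toy, 𝕍^bad ≠ ∅]. ([IUTchI] Def 4.6 (ii) p.111) [claim: Mochizuki2012, status: disputed] -/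
theorem isModelConjugate_iff_exists_dThetaBridge_ofKit_toy (D : (toyKitBad l hl5).thicken.DThetaBridgeData) :
    (∃ (e : D.J ≃ Fin ((l - 1) / 2))
        (κ : ∀ j, (PMBaseKit.DStrip.model (toyKitBad l hl5).thicken).Iso (D.capsule j))
        (δ : (PMBaseKit.DStrip.model (toyKitBad l hl5).thicken).Iso D.codomain),
        (∀ (j : D.J) (v : (toyKitBad l hl5).thicken.V) (hv : v ∈ (toyKitBad l hl5).thicken.bad), D.poly j v =
            {h | ∃ g ∈ ((toyKitBad l hl5).thickMultKit hl5 (toyKitBad_disjoint hl5)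
                (toyKitBad_bad_nonempty hl5)).thetaPolyBad (e j) v hv, h = (κ j v).inv ≫ g ≫ (δ v).hom}) ∧
        (∀ (j : D.J) (v : (toyKitBad l hl5).thicken.V), v ∉ (toyKitBad l hl5).thicken.bad → D.poly j v =
            {h | ∃ g : (toyKitBad l hl5).thicken.model v ≅ (toyKitBad l hl5).thicken.model v,
              h = (κ j v).inv ≫ g.hom ≫ (δ v).hom})) ↔
    ∃ (B' : (ofKitCore (toyKitBad l hl5).thicken hl5 (toyKitBad_bad_not_arc hl5) (toyKitBad_bad_nonempty hl5)
          (NFKit.toyBad l hl5) (MonoBinder.tautological _)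
          (EvalBinder.thickMult (toyKitBad l hl5) hl5 (toyKitBad_disjoint hl5) (toyKitBad_bad_nonempty hl5))).DThetaBridge)
      (ι : D.J ≃ B'.J) (κ : ∀ j x, (B'.capsule (ι j) x).obj ≅ (D.capsule j).obj x)
      (γ : ∀ x, (B'.cod x).obj ≅ D.codomain.obj x),
      ∀ j x, D.poly j x = {g | ∃ f ∈ B'.poly (ι j) x, g = (κ j x).inv ≫ f.hom ≫ (γ x).hom} :=
  isModelConjugate_iff_exists_dThetaBridge_ofKit _ hl5 _ _ _ _ _ _ _ _
    ((toyKitBad l hl5).thickMultKit_thetaPolyBad_saturated hl5 (toyKitBad_disjoint hl5)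
      (toyKitBad_bad_nonempty hl5)) D

/-- **KIT-RULE for `thetaAgrees_ofKit`** (packaged): for every prime `l ≥ 5` there are a base kit with a bad place and
no bad archimedean place, an NF kit, a mono-analytic binder, a multiplicative kit `M` and a zero class `Z` satisfying
`hne`, `hrig` and the bi-saturation `hsat`, at which the converse dictionary Θ-agrees with `M`.
([IUTchI] Prop 6.7 p.167) [claim: Mochizuki2012, status: disputed] -/
theorem exists_thetaAgrees_ofKit :
    ∃ (K : PMBaseKit.{0} l) (hba : ∀ x ∈ K.bad, x ∉ K.arc) (hb : K.bad.Nonempty) (N : K.NFKit) (B : K.MonoBinder)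
      (M : K.MultKit) (Z : ∀ x : K.V, x ∈ K.bad → Set (K.model x ⟶ K.model x))
      (hne : ∀ x (hx : x ∈ K.bad) j, (M.polyOfLabel hl5 Z x hx j).Nonempty)
      (hrig : ∀ x (hx : x ∈ K.bad) {j j' : FlAbs l} {g g' : K.model x ⟶ K.model x}
        (θ β : K.model x ≅ K.model x), g ∈ M.polyOfLabel hl5 Z x hx j → g' ∈ M.polyOfLabel hl5 Z x hx j' →
          g' = θ.hom ≫ g ≫ β.hom → j = j'),
      (∀ x (hx : x ∈ K.bad) (j : Fin (lStar l)) (θ β : K.model x ≅ K.model x) {g : K.model x ⟶ K.model x},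
          g ∈ M.thetaPolyBad j x hx → θ.hom ≫ g ≫ β.hom ∈ M.thetaPolyBad j x hx) ∧
        (KitCore.ofKit K hl5 hba hb N B (M.evalBinder hl5 Z hne hrig)).ThetaAgrees M :=
  ⟨_, _, _, _, _, _, _, _, _,
    (toyKitBad l hl5).thickMultKit_thetaPolyBad_saturated hl5 (toyKitBad_disjoint hl5) (toyKitBad_bad_nonempty hl5),
    thetaAgrees_ofKit_toy l hl5⟩

end Toy

end BaseThetaDatum

end Literature.IUT.HodgeTheaters
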